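import Mathlib.Data.Nat.Totient
import Mathlib.NumberTheory.Divisors
import Mathlib.NumberTheory.ArithmeticFunction.Moebius
import Mathlib.LinearAlgebra.Matrix.Trace
import Mathlib.LinearAlgebra.Matrix.PosDef
import Mathlib.Data.Rat.Star
import Mathlib.RingTheory.RootsOfUnity.PrimitiveRoots
import HarnessLib

/-!
# Haran's ring `𝒲 = 𝒲(Spec ℤ ∪ {η})` at finite level `N`: the Frobenius operators `F_m` on
`𝒲_N = ⊕_{d ∣ N} ℤ φ_d`, their trace, and the inner product `⟨φ_a, φ_b⟩ = δ_{ab} φ(a)`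
(Haran 2022, §13)

Source (read at the page; held as `lit paper:arxiv-2209.08536`, §13 = text chunks p0020–p0021):
M. J. Shai Haran, *Non-Additive Geometry and Frobenius Correspondences*, arXiv:2209.08536 (2022),
§12 "The Witt ring and Frobenius correspondences" and §13 "The ring `𝒲 = 𝒲(Spec ℤ ∪ {η})`"
[Haran2022].  For the compactified `Spec ℤ ∪ {η}` Haran's Witt ring of §12 (`F_n [p] = [p^n]`,
`𝒲(𝒫_R)` = free abelian group on Galois orbits `[α]`, `F_m [α] = [α^m]`) has global sections
(§13, first display)

  `𝒲(Spec ℤ ∪ {η}) = ⊕_{n ≥ 1} ℤ·φ_n = ⊕_{n ≥ 1} ℤ[μ_n^*]`,  `φ_n` = the orbit of primitive `n`-th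
  roots of unity,

"is the union of its finite subalgebras `𝒲 = ⋃_{N ≥ 1} 𝒲_N`, `𝒲_N = ⊕_{d ∣ N} ℤ φ_d`", and carries
"completely multiplicative" Frobenius ring endomorphisms, `F_{m₁} ∘ F_{m₂} = F_{m₁ m₂}`, given by

  `F_p φ_n = φ_n (p ∤ n)`, `= p·φ_{n/p} (p² ∣ n)`, `= (p-1)·φ_{n/p} (p ∣ n, p² ∤ n)`  (p prime),
  `F_m φ_n = (m,n) · (∏_{p ∣ (m,n), p ∤ n/(m,n)} (1 - p⁻¹)) · φ_{n/(m,n)}`,  `(m,n) = gcd(m,n)`;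

the trace `tr φ_n = ∑_{ξ ∈ μ_n^*} ξ = μ(n)`, the functionals `t_m = tr ∘ F_m` with
`t_m(φ_n) = ∑_{ξ ∈ μ_n^*} ξ^m = C_n^m`, "with the Ramanujan sums
`C_n^m = μ(n/(n,m)) · φ(n)/φ(n/(n,m))`"; `m ≡ 0 (mod n) ⇒ F_m φ_n = φ(n)·φ_1`; the limit
`F_0 = lim_{m → 0 ∈ Ẑ} F_m`, `F_0 ∘ F_m = F_0`, `F_0 φ_n = #μ_n^* = φ(n)`; and the additive
projection `∫ φ_n = δ_{n,1}` with `∫(φ_{n₁}·φ_{n₂}) = δ_{n₁ n₂} φ(n₁)`, giving the inner product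
`⟨f, g⟩ = ∫ (f·ḡ)` "with orthogonal basis `{φ_n}_{n ≥ 1}`, `‖φ_n‖² = φ(n)`".

## Content (everything PROVED; no named facts; definitions with bodies)

Finite level `N`: the index type is the subtype of `N.divisors` (empty for `N = 0`), scalars `ℚ`
(the printed coefficients `(1 - p⁻¹)` are rational), operators as matrices in the basis
`(φ_d)_{d ∣ N}` acting on coordinate columns.

* `target m n = n/(m,n)` — the basis index hit by `F_m φ_n`; `coeff m n = φ(n)/φ(n/(m,n))` — its
  coefficient, in the closed form read off from the printed `t_m(φ_n)` (with `tr φ_k = μ(k)`);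
  `coeffPrinted m n = (m,n)·∏_{p ∣ (m,n), p ∤ n/(m,n)} (1 - p⁻¹)` — the coefficient AS PRINTED, and
  `coeffPrinted_eq_coeff` : the two agree (the last display of Hardy–Wright's proof of Thm 272,
  [HardyWright2008, §16.6]).  The printed prime case: `coeff_of_prime_not_dvd` (`= 1`),
  `coeff_of_prime_sq_dvd` (`= p`), `coeff_of_prime_dvd_not_sq` (`= p - 1`); `coeff_of_dvd_left`
  (`m ≡ 0 (mod n)`: `= φ(n)`, target `φ_1`); `coeff_zero_left`/`target_zero_left` (Lean's
  `gcd 0 n = n` makes `m = 0` literally Haran's `F_0`: `F_0 φ_n = φ(n) φ_1`).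
* `frob N m` — the matrix of `F_m` on `𝒲_N ⊗ ℚ`; `frob_one` (`F_1 = 1`), **`frob_mul`**
  (`F_a F_b = F_{ab}`, complete multiplicativity, via the gcd identity
  `(ab,n) = (b,n)·(a, n/(b,n))`, `gcd_mul_eq` / `target_target`), `frob_comm`, `frob_zero_mul`
  (`F_0 ∘ F_m = F_0`), `frob_zero_apply`.
* **`trace_frob`**: `tr(F_m | 𝒲_N) = #{d ∣ N : (m,d) = 1}` — the number of fixed points of
  `d ↦ d/(m,d)` on the divisors of `N` (a Lefschetz count, an integer ≥ 0 for every `m`);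
  `trace_frob_prime_pow`: `tr(F_{p^k} | 𝒲_N) = #{d ∣ N : p ∤ d}`.
* `moebius_dotProduct_frob`: pairing the column of `φ_d` with `(μ(e))_{e ∣ N}` gives the printed
  `t_m(φ_d) = μ(d/(d,m))·φ(d)/φ(d/(d,m))` (Hölder's closed form of the Ramanujan sum `c_d(m)`,
  Hardy–Wright Thm 272; the tree's exponential-sum `Literature.NumberTheory.Sieve.ramanujanSum`
  is in Kluyver's form — the identification of the two forms is not made in this file).
* `gram N = diag(φ(d))`, `gram_posDef`; `frobAdj N m` (`F_m† φ_d = ∑_{e/(m,e) = d} φ_e`, the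
  transpose of the transport matrix of `e ↦ e/(m,e)`) and **`frob_transpose_mul_gram`**:
  `F_mᵀ G = G F_m†`, i.e. `⟨F_m x, y⟩ = ⟨x, F_m† y⟩`.
* Scope remark `frob_transpose_mul_gram_ne_verschiebung`: the additive map `φ_n ↦ φ_{mn}`, which
  the source calls "the adjoint of `F_m`, the 'verschiebung' `F_m^*`", is not the adjoint for the
  inner product above (`⟨F_2 φ_1, φ_1⟩ = 1 ≠ 0 = ⟨φ_1, φ_2⟩`; checked at level `N = 2`).  We record
  the printed map as `verschiebung` and the `⟨·,·⟩`-adjoint as `frobAdj`; nothing else in this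
  file depends on that sentence of the source.
* Orbit model `isPrimitiveRoot_pow_target`: in any commutative monoid the `m`-th power of a
  primitive `n`-th root of unity is a primitive `n/(m,n)`-th root of unity — why `F_m [ξ] = [ξ^m]`
  maps the orbit `φ_n` onto (a multiple of) `φ_{n/(m,n)}`.

## Relation to other tree files

`𝒲_N ⊗ ℚ` is the `(ℤ/Nℤ)^*`-invariant part of the Bost–Connes level `ℚ[ℤ/Nℤ]` with its
endomorphisms `σ_m : e(γ) ↦ e(mγ)` (`Literature.NumberTheory.BostConnes.sigmaMatrix`, whose trace
is `#{γ : mγ = γ} = gcd(N, m-1)`); here the basis is by orbits (= by the order `d ∣ N` of `γ`) and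
the trace counts fixed ORBITS `#{d ∣ N : (m,d) = 1}`.  The companion `𝔽₁`/Λ-ring files are
`Literature.Barriers.RiemannHypothesis.IntegralLambdaRingsCyclotomic` (`ℤ[μ_r]`, `ψ_n z = z^n`,
trace = number of fixed points) and `…AbsoluteZetaPolynomialCounting`.

## Not here

The multiplication of `𝒲` (`φ_n·φ_m = φ_{nm}` for `(n,m) = 1`, the `φ_{p^n}·φ_{p^m}` table) and the
fact that the `F_m` are RING endomorphisms; the tensor decomposition `𝒲 = ⊗_p 𝒲_{p^∞}`; the
`ℤ`-integrality of `F_m` on `⊕ ℤ φ_d` (the coefficients `φ(n)/φ(n/(m,n))` are integers; we work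
over `ℚ`); Remark 20 (`CRing(𝒲, ℂ) = Ẑ/Ẑ^*`); the completion `ℋ = 𝒲̂_ℂ`, the elements `ζ(F,s)`,
`ζ(F^*,s)` and their Ramanujan-sum evaluations, the Fourier transform to `L²(Ẑ)^{Ẑ^*}`, the special
λ-ring structure and γ-filtration (rest of §13); the identification `t_m(φ_n) = ∑_{ξ ∈ μ_n^*} ξ^m`
with an exponential sum and the orbit multiplicity `#{ξ ∈ μ_n^* : ξ^m = ξ₀} = φ(n)/φ(n/(m,n))`.
-/

namespace Literature.NumberTheory.F1Geometry

open Finset Matrix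

namespace HaranWitt

/-- The index of the basis vector hit by `F_m φ_n`: `F_m φ_n ∈ ℚ φ_{n/(m,n)}` where
`(m,n) = gcd(m,n)` (Haran 2022, §13, display `F_m φ_n = (m,n)·(∏ …)·φ_{n/(m,n)}`). For `m = 0`
Lean's `gcd 0 n = n` gives `target 0 n = 1`, which is Haran's `F_0 φ_n = φ(n) φ_1`.
[cite: Haran2022, §13] -/
def target (m n : ℕ) : ℕ := n / Nat.gcd m n

/-- `n/(m,n)` divides `n`. [cite: Haran2022, §13] -/
theorem target_dvd (m n : ℕ) : target m n ∣ n := Nat.div_dvd_of_dvd (Nat.gcd_dvd_right m n)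

/-- `(m,n) · (n/(m,n)) = n`. [folklore] -/
private theorem gcd_mul_target (m n : ℕ) : Nat.gcd m n * target m n = n :=
  Nat.mul_div_cancel' (Nat.gcd_dvd_right m n)

/-- `n/(m,n) > 0` for `n > 0`. [folklore] -/
private theorem target_pos (m : ℕ) {n : ℕ} (hn : 0 < n) : 0 < target m n :=
  Nat.div_pos (Nat.le_of_dvd hn (Nat.gcd_dvd_right m n)) (Nat.gcd_pos_of_pos_right m hn)

/-- `F_m` preserves the level: `d ∣ N ⇒ d/(m,d) ∣ N`. [cite: Haran2022, §13] -/
theorem target_mem_divisors {N d : ℕ} (m : ℕ) (hd : d ∈ N.divisors) : target m d ∈ N.divisors := by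
  rw [Nat.mem_divisors] at hd ⊢
  exact ⟨(target_dvd m d).trans hd.1, hd.2⟩

/-- `F_1 = id` on indices: `n/(1,n) = n`. [folklore] -/
@[simp] private theorem target_one_left (n : ℕ) : target 1 n = n := by simp [target]

/-- `F_0 φ_n = φ(n) φ_1`: the index is `n/(0,n) = n/n = 1` (`n > 0`). [cite: Haran2022, §13] -/
theorem target_zero_left {n : ℕ} (hn : 0 < n) : target 0 n = 1 := by
  simp [target, Nat.div_self hn]

/-- `m ≡ 0 (mod n) ⇒ F_m φ_n ∈ ℚ φ_1`. [cite: Haran2022, §13] -/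
theorem target_of_dvd_left {m n : ℕ} (hn : 0 < n) (h : n ∣ m) : target m n = 1 := by
  rw [target, Nat.gcd_eq_right h, Nat.div_self hn]

/-- `φ_n` is fixed by `F_m` (as a line) iff `(m,n) = 1`. [folklore] -/
private theorem target_eq_self_iff {m n : ℕ} (hn : 0 < n) : target m n = n ↔ Nat.Coprime m n := by
  constructor
  · intro h
    have hg := gcd_mul_target m n
    rw [h] at hg
    exact Nat.eq_of_mul_eq_mul_right hn (hg.trans (one_mul n).symm)
  · intro h
    rw [target, Nat.Coprime.gcd_eq_one h, Nat.div_one]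

/-- The gcd identity behind complete multiplicativity: `(ab, n) = (b, n) · (a, n/(b,n))`.
[folklore] -/
private theorem gcd_mul_eq (a b n : ℕ) : Nat.gcd (a * b) n = Nat.gcd b n * Nat.gcd a (target b n) := by
  rcases Nat.eq_zero_or_pos n with rfl | hn
  · simp [target, Nat.mul_comm]
  obtain ⟨g, b', n', hg0, hcop, rfl, rfl⟩ := Nat.exists_coprime' (Nat.gcd_pos_of_pos_right b hn)
  have hg : Nat.gcd (b' * g) (n' * g) = g := by rw [Nat.gcd_mul_right, hcop.gcd_eq_one, one_mul]
  have ht : target (b' * g) (n' * g) = n' := by rw [target, hg, Nat.mul_div_cancel _ hg0]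
  rw [ht, hg, show a * (b' * g) = (a * b') * g by ring, Nat.gcd_mul_right,
    Nat.Coprime.gcd_mul_right_cancel a hcop, mul_comm]

/-- `F_a ∘ F_b` and `F_{ab}` hit the same basis vector: `(n/(b,n))/(a, n/(b,n)) = n/(ab,n)`.
[cite: Haran2022, §13] -/
theorem target_target (a b n : ℕ) : target a (target b n) = target (a * b) n := by
  rcases Nat.eq_zero_or_pos n with rfl | hn
  · simp [target]
  obtain ⟨g, b', n', hg0, hcop, rfl, rfl⟩ := Nat.exists_coprime' (Nat.gcd_pos_of_pos_right b hn)
  have hg : Nat.gcd (b' * g) (n' * g) = g := by rw [Nat.gcd_mul_right, hcop.gcd_eq_one, one_mul]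
  have ht : target (b' * g) (n' * g) = n' := by rw [target, hg, Nat.mul_div_cancel _ hg0]
  rw [ht, target, target, show a * (b' * g) = (a * b') * g by ring, Nat.gcd_mul_right,
    Nat.Coprime.gcd_mul_right_cancel a hcop, Nat.mul_div_mul_right _ _ hg0]

/-! ### The coefficients -/

/-- The coefficient of `φ_{n/(m,n)}` in `F_m φ_n`, in the closed form `φ(n)/φ(n/(m,n))` read off
from Haran's evaluation `t_m(φ_n) = tr(F_m φ_n) = C_n^m = μ(n/(n,m))·φ(n)/φ(n/(n,m))` with
`tr φ_k = μ(k)` (Haran 2022, §13, displays `t_m(φ_n) = …` and `C_n^m = …`); it equals the printed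
product `(m,n)·∏_{p ∣ (m,n), p ∤ n/(m,n)} (1 - p⁻¹)` (`coeffPrinted_eq_coeff`, Hardy–Wright Thm 272's
last display). [cite: Haran2022, §13] -/
def coeff (m n : ℕ) : ℚ := (Nat.totient n : ℚ) / (Nat.totient (target m n) : ℚ)

/-- Haran's coefficient AS PRINTED: `(m,n) · ∏_{p ∣ (m,n), p ∤ n/(m,n)} (1 - p⁻¹)` (Haran 2022,
§13, display `F_m φ_n = (m,n)·(∏_{p ∣ (m,n), p ∤ n/(m,n)} (1-p⁻¹))·φ_{n/(m,n)}`).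
[cite: Haran2022, §13] -/
def coeffPrinted (m n : ℕ) : ℚ :=
  (Nat.gcd m n : ℚ) * ∏ p ∈ (Nat.gcd m n).primeFactors with ¬ p ∣ target m n, (1 - (p : ℚ)⁻¹)

/-- `φ(k) ≠ 0` in `ℚ` for `k > 0`. [folklore] -/
private theorem totient_cast_ne_zero {k : ℕ} (hk : 0 < k) : (Nat.totient k : ℚ) ≠ 0 :=
  Nat.cast_ne_zero.mpr (Nat.totient_pos.mpr hk).ne'

/-- `F_1 φ_n = φ_n`: coefficient `1`. [cite: Haran2022, §13] -/
theorem coeff_one_left {n : ℕ} (hn : 0 < n) : coeff 1 n = 1 := by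
  rw [coeff, target_one_left, div_self (totient_cast_ne_zero hn)]

/-- `F_0 φ_n = φ(n) φ_1`: coefficient `φ(n)` (Haran 2022, §13, `F_0 φ_n = #μ_n^* = φ(n)`).
[cite: Haran2022, §13] -/
theorem coeff_zero_left {n : ℕ} (hn : 0 < n) : coeff 0 n = Nat.totient n := by
  rw [coeff, target_zero_left hn, Nat.totient_one, Nat.cast_one, div_one]

/-- `m ≡ 0 (mod n) ⇒ F_m φ_n = φ(n)·φ_1` (Haran 2022, §13). [cite: Haran2022, §13] -/
theorem coeff_of_dvd_left {m n : ℕ} (hn : 0 < n) (h : n ∣ m) : coeff m n = Nat.totient n := by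
  rw [coeff, target_of_dvd_left hn h, Nat.totient_one, Nat.cast_one, div_one]

/-- `(m,n) = 1 ⇒ F_m φ_n = φ_n`: coefficient `1`. [cite: Haran2022, §13] -/
theorem coeff_of_coprime {m n : ℕ} (hn : 0 < n) (h : Nat.Coprime m n) : coeff m n = 1 := by
  rw [coeff, (target_eq_self_iff hn).mpr h, div_self (totient_cast_ne_zero hn)]

/-- Multiplicativity of the coefficients along `F_a ∘ F_b = F_{ab}`:
`(φ(n')/φ(n'')) · (φ(n)/φ(n')) = φ(n)/φ(n'')` with `n' = n/(b,n)`, `n'' = n'/(a,n') = n/(ab,n)`.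
[cite: Haran2022, §13] -/
theorem coeff_mul {n : ℕ} (hn : 0 < n) (a b : ℕ) :
    coeff a (target b n) * coeff b n = coeff (a * b) n := by
  simp only [coeff, target_target]
  rw [div_mul_div_comm, mul_comm (Nat.totient (target b n) : ℚ), ← div_mul_div_comm,
    div_self (totient_cast_ne_zero (target_pos b hn)), mul_one]

/-! ### The printed prime case `F_p` -/

/-- `p ∤ n ⇒ n/(p,n) = n`. [cite: Haran2022, §13] -/
theorem target_of_prime_not_dvd {p n : ℕ} (hp : p.Prime) (h : ¬ p ∣ n) : target p n = n := by
  rw [target, (hp.coprime_iff_not_dvd.mpr h).gcd_eq_one, Nat.div_one]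

/-- `p ∣ n ⇒ n/(p,n) = n/p`. [cite: Haran2022, §13] -/
theorem target_of_prime_dvd {p n : ℕ} (h : p ∣ n) : target p n = n / p := by
  rw [target, Nat.gcd_eq_left h]

/-- Printed case 1: `p ∤ n ⇒ F_p φ_n = φ_n` (coefficient `1`). [cite: Haran2022, §13] -/
theorem coeff_of_prime_not_dvd {p n : ℕ} (hp : p.Prime) (hn : 0 < n) (h : ¬ p ∣ n) :
    coeff p n = 1 :=
  coeff_of_coprime hn (hp.coprime_iff_not_dvd.mpr h)

/-- Printed case 2: `p² ∣ n ⇒ F_p φ_n = p · φ_{n/p}`. [cite: Haran2022, §13] -/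
theorem coeff_of_prime_sq_dvd {p n : ℕ} (hp : p.Prime) (hn : 0 < n) (h : p ^ 2 ∣ n) :
    coeff p n = p := by
  obtain ⟨k, rfl⟩ := h
  have hp0 : 0 < p := hp.pos
  have hk : 0 < p * k := by
    rcases Nat.eq_zero_or_pos k with rfl | hk
    · simp at hn
    · exact Nat.mul_pos hp0 hk
  have hdiv : p ∣ p ^ 2 * k := dvd_mul_of_dvd_left (dvd_pow_self p two_ne_zero) k
  rw [coeff, target_of_prime_dvd hdiv, show p ^ 2 * k = p * (p * k) by ring,
    Nat.mul_div_cancel_left _ hp0, Nat.totient_mul_of_prime_of_dvd hp (dvd_mul_right p k),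
    Nat.cast_mul, mul_div_assoc, div_self (totient_cast_ne_zero hk), mul_one]

/-- Printed case 3: `p ∣ n, p² ∤ n ⇒ F_p φ_n = (p - 1) · φ_{n/p}`. [cite: Haran2022, §13] -/
theorem coeff_of_prime_dvd_not_sq {p n : ℕ} (hp : p.Prime) (hn : 0 < n) (h : p ∣ n)
    (h2 : ¬ p ^ 2 ∣ n) : coeff p n = p - 1 := by
  obtain ⟨k, rfl⟩ := h
  have hp0 : 0 < p := hp.pos
  have hk : 0 < k := Nat.pos_of_mul_pos_left hn
  have hpk : ¬ p ∣ k := fun hd => h2 (by rw [pow_two]; exact Nat.mul_dvd_mul_left p hd)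
  rw [coeff, target_of_prime_dvd (dvd_mul_right p k), Nat.mul_div_cancel_left _ hp0,
    Nat.totient_mul_of_prime_of_not_dvd hp hpk, Nat.cast_mul, mul_div_assoc,
    div_self (totient_cast_ne_zero hk), mul_one, Nat.cast_sub hp0, Nat.cast_one]

/-! ### The printed product equals `φ(n)/φ(n/(m,n))` (Hardy–Wright, proof of Thm 272) -/

/-- Each Euler factor `1 - p⁻¹` of a prime is non-zero in `ℚ`. [folklore] -/
private theorem one_sub_inv_ne_zero {p : ℕ} (hp : p.Prime) : (1 - (p : ℚ)⁻¹) ≠ 0 := by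
  have hp1 : (1 : ℚ) < p := by exact_mod_cast hp.one_lt
  have : (p : ℚ)⁻¹ < 1 := inv_lt_one_of_one_lt₀ hp1
  linarith

/-- **The printed coefficient is `φ(n)/φ(n/(m,n))`**: with `a = (m,n)`, `N = n/a`,
`a · ∏_{p ∣ a, p ∤ N} (1 - p⁻¹) = φ(n)/φ(N)` — the last display in Hardy–Wright's proof of
Thm 272 (from Thm 62, `φ(n) = n ∏_{p ∣ n} (1 - p⁻¹)`), which is how Haran's two descriptions of
`F_m φ_n` (the product formula and `t_m(φ_n) = μ(n/(n,m)) φ(n)/φ(n/(n,m))`) agree.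
[cite: HardyWright2008, §16.6 Thm 272 (proof)] -/
theorem coeffPrinted_eq_coeff (m : ℕ) {n : ℕ} (hn : 0 < n) : coeffPrinted m n = coeff m n := by
  have hn0 : n ≠ 0 := hn.ne'
  set g := Nat.gcd m n with hg
  set t := target m n with ht
  have hgt : g * t = n := gcd_mul_target m n
  have ht0 : 0 < t := target_pos m hn
  have hg0 : 0 < g := Nat.gcd_pos_of_pos_right m hn
  have hsub : t.primeFactors ⊆ n.primeFactors := Nat.primeFactors_mono (target_dvd m n) hn0
  have hprod_t : (∏ p ∈ t.primeFactors, (1 - (p : ℚ)⁻¹)) ≠ 0 :=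
    Finset.prod_ne_zero_iff.mpr fun p hp => one_sub_inv_ne_zero (Nat.prime_of_mem_primeFactors hp)
  -- the set of primes `p ∣ a, p ∤ N` is `n.primeFactors \ N.primeFactors`
  have hset : (g.primeFactors.filter fun p => ¬ p ∣ t) = n.primeFactors \ t.primeFactors := by
    ext p
    simp only [Finset.mem_filter, Finset.mem_sdiff, Nat.mem_primeFactors, ne_eq]
    constructor
    · rintro ⟨⟨hp, hpg, -⟩, hpt⟩
      exact ⟨⟨hp, hpg.trans (Dvd.intro t hgt), hn0⟩, fun h => hpt h.2.1⟩
    · rintro ⟨⟨hp, hpn, -⟩, hnot⟩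
      have hpt : ¬ p ∣ t := fun h => hnot ⟨hp, h, ht0.ne'⟩
      refine ⟨⟨hp, ?_, hg0.ne'⟩, hpt⟩
      rw [← hgt] at hpn
      exact (hp.dvd_mul.mp hpn).resolve_right hpt
  rw [coeffPrinted, coeff, ← hg, ← ht, hset, Nat.totient_eq_mul_prod_factors n,
    Nat.totient_eq_mul_prod_factors t, ← Finset.prod_sdiff hsub]
  have ht0' : (t : ℚ) ≠ 0 := Nat.cast_ne_zero.mpr ht0.ne'
  have hgn : (n : ℚ) = g * t := by rw [← hgt, Nat.cast_mul]
  rw [hgn, eq_div_iff (mul_ne_zero ht0' hprod_t)]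
  ring

/-! ### The level-`N` operators as matrices in the basis `(φ_d)_{d ∣ N}` -/

/-- **Haran's Frobenius `F_m` on `𝒲_N ⊗ ℚ`** (`𝒲_N = ⊕_{d ∣ N} ℤ φ_d`, Haran 2022 §13, display
`𝒲 = ⋃_N 𝒲_N`), as the matrix in the basis `(φ_d)_{d ∣ N}`: the column of `φ_d` has the single
entry `φ(d)/φ(d/(m,d))` in the row of `φ_{d/(m,d)}` (the printed
`F_m φ_n = (m,n)·∏(1-p⁻¹)·φ_{n/(m,n)}`, cf. `coeffPrinted_eq_coeff`), i.e.
`(frob N m).mulVec` acts on coordinate vectors. The index type is the subtype of `N.divisors`; for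
`N = 0` it is empty. [cite: Haran2022, §13] -/
def frob (N m : ℕ) : Matrix N.divisors N.divisors ℚ :=
  Matrix.of fun e d => if (e : ℕ) = target m d then coeff m d else 0

/-- Entry formula for `frob`. [cite: Haran2022, §13] -/
theorem frob_apply (N m : ℕ) (e d : N.divisors) :
    frob N m e d = if (e : ℕ) = target m d then coeff m d else 0 := rfl

/-- The basis index `φ_{d/(m,d)}` as an element of the index type. [folklore] -/
def targetIdx {N : ℕ} (m : ℕ) (d : N.divisors) : N.divisors :=
  ⟨target m d, target_mem_divisors m d.2⟩

/-- Coercion of `targetIdx`. [folklore] -/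
@[simp] private theorem coe_targetIdx {N : ℕ} (m : ℕ) (d : N.divisors) :
    (targetIdx m d : ℕ) = target m d := rfl

/-- **`F_1 = id`.** [cite: Haran2022, §13] -/
theorem frob_one (N : ℕ) : frob N 1 = 1 := by
  ext e d
  have hd : 0 < (d : ℕ) := Nat.pos_of_mem_divisors d.2
  rw [frob_apply, target_one_left, coeff_one_left hd, Matrix.one_apply]
  simp only [Subtype.ext_iff]

/-- **Complete multiplicativity** `F_a ∘ F_b = F_{ab}` (Haran 2022, §13, display
`F_{m₁} ∘ F_{m₂} = F_{m₁·m₂}`), at every finite level `N`, as a matrix identity.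
[cite: Haran2022, §13] -/
theorem frob_mul (N a b : ℕ) : frob N a * frob N b = frob N (a * b) := by
  ext e d
  have hd : 0 < (d : ℕ) := Nat.pos_of_mem_divisors d.2
  rw [Matrix.mul_apply, Finset.sum_eq_single (targetIdx b d)]
  · rw [frob_apply, frob_apply, frob_apply, coe_targetIdx, if_pos rfl, target_target]
    by_cases h : (e : ℕ) = target (a * b) d
    · rw [if_pos h, if_pos h, coeff_mul hd]
    · rw [if_neg h, if_neg h, zero_mul]
  · intro k _ hk
    rw [frob_apply N b, if_neg, mul_zero]
    intro h
    exact hk (Subtype.ext h)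
  · intro h; exact absurd (Finset.mem_univ _) h

/-- The `F_m` commute. [cite: Haran2022, §13] -/
theorem frob_comm (N a b : ℕ) : frob N a * frob N b = frob N b * frob N a := by
  rw [frob_mul, frob_mul, mul_comm]

/-- `F_0 ∘ F_m = F_0` (Haran 2022, §13: "We have `F_0 ∘ F_m = F_0` for all `m`"), here with
`F_0` the level-`N` operator `φ_d ↦ φ(d) φ_1` (Lean's `gcd 0 d = d`). [cite: Haran2022, §13] -/
theorem frob_zero_mul (N m : ℕ) : frob N 0 * frob N m = frob N 0 := by
  rw [frob_mul, zero_mul]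

/-- `F_0 φ_d = φ(d) · φ_1` at level `N` (Haran 2022, §13, `F_0 φ_n = # μ_n^* = φ(n)`).
[cite: Haran2022, §13] -/
theorem frob_zero_apply (N : ℕ) (e d : N.divisors) :
    frob N 0 e d = if (e : ℕ) = 1 then (Nat.totient d : ℚ) else 0 := by
  have hd : 0 < (d : ℕ) := Nat.pos_of_mem_divisors d.2
  rw [frob_apply, target_zero_left hd, coeff_zero_left hd]

/-! ### Trace: `tr(F_m | 𝒲_N) = #{d ∣ N : (m,d) = 1}` — a count of fixed divisors -/

/-- **Lefschetz count.** The trace of `F_m` on `𝒲_N ⊗ ℚ` is the number of divisors `d ∣ N`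
with `(m, d) = 1` (the fixed points of `d ↦ d/(m,d)`; each fixed `φ_d` has coefficient
`φ(d)/φ(d) = 1`). In particular it is a non-negative integer for every `m`.
[cite: Haran2022, §13] -/
theorem trace_frob (N m : ℕ) :
    (frob N m).trace = ((N.divisors.filter fun d => Nat.Coprime m d).card : ℚ) := by
  rw [Matrix.trace]
  simp only [Matrix.diag_apply, frob_apply]
  rw [Finset.sum_coe_sort N.divisors (fun d : ℕ => if d = target m d then coeff m d else 0),
    Finset.card_filter]
  push_cast
  refine Finset.sum_congr rfl fun d hd => ?_
  have hd0 : 0 < d := Nat.pos_of_mem_divisors hd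
  by_cases h : Nat.Coprime m d
  · rw [if_pos ((target_eq_self_iff hd0).mpr h).symm, if_pos h, coeff_of_coprime hd0 h]
  · rw [if_neg (fun h' => h ((target_eq_self_iff hd0).mp h'.symm)), if_neg h]

/-- For a prime power `m = p^k` (`k ≥ 1`): `tr(F_{p^k} | 𝒲_N) = #{d ∣ N : p ∤ d}`, independent
of `k`. [cite: Haran2022, §13] -/
theorem trace_frob_prime_pow (N : ℕ) {p k : ℕ} (hp : p.Prime) (hk : 0 < k) :
    (frob N (p ^ k)).trace = ((N.divisors.filter fun d => ¬ p ∣ d).card : ℚ) := by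
  rw [trace_frob]
  congr 2
  refine Finset.filter_congr fun d _ => ?_
  rw [Nat.coprime_pow_left_iff hk, hp.coprime_iff_not_dvd]

/-! ### The inner product `⟨φ_a, φ_b⟩ = δ_{ab} φ(a)` and the adjoint of `F_m` -/

/-- **Haran's inner product** on `𝒲_N`: `⟨f, g⟩ = ∫ f·ḡ` with `∫ φ_n = δ_{n,1}`,
`∫(φ_{n₁} φ_{n₂}) = δ_{n₁ n₂} φ(n₁)`, so `(φ_d)` is an orthogonal basis with `‖φ_d‖² = φ(d)`
(Haran 2022, §13, displays `∫(φ_{n₁}·φ_{n₂}) = …` and `⟨f,g⟩ = ∫(f·ḡ)`, "with orthogonal basis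
`{φ_n}`, `‖φ_n‖² = φ(n)`"): the Gram matrix `diag(φ(d))_{d ∣ N}`. [cite: Haran2022, §13] -/
def gram (N : ℕ) : Matrix N.divisors N.divisors ℚ :=
  Matrix.diagonal fun d => (Nat.totient d : ℚ)

/-- The Gram matrix is positive definite (`φ(d) > 0`). [cite: Haran2022, §13] -/
theorem gram_posDef (N : ℕ) : (gram N).PosDef :=
  Matrix.posDef_diagonal_iff.mpr fun d =>
    Nat.cast_pos.mpr (Nat.totient_pos.mpr (Nat.pos_of_mem_divisors d.2))

/-- The `⟨·,·⟩`-adjoint of `F_m` at level `N`: `F_m† φ_d = ∑_{e ∣ N, e/(m,e) = d} φ_e` — the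
transpose of the transport matrix of `e ↦ e/(m,e)` (column `d` has a `1` in every row `e` that
`F_m` sends onto the line of `φ_d`). [cite: Haran2022, §13] -/
def frobAdj (N m : ℕ) : Matrix N.divisors N.divisors ℚ :=
  Matrix.of fun e d => if (d : ℕ) = target m e then 1 else 0

/-- Entry formula for `frobAdj`. [folklore] -/
private theorem frobAdj_apply (N m : ℕ) (e d : N.divisors) :
    frobAdj N m e d = if (d : ℕ) = target m e then 1 else 0 := rfl

/-- **Adjunction** `⟨F_m x, y⟩ = ⟨x, F_m† y⟩`, as the matrix identity `F_mᵀ G = G F_m†` with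
`G = gram N`: entrywise `[b = d/(m,d)] · (φ(d)/φ(b)) · φ(b) = φ(d) · [b = d/(m,d)]`.
[cite: Haran2022, §13] -/
theorem frob_transpose_mul_gram (N m : ℕ) :
    (frob N m)ᵀ * gram N = gram N * frobAdj N m := by
  ext d b
  rw [gram, Matrix.mul_diagonal, Matrix.diagonal_mul, Matrix.transpose_apply, frob_apply,
    frobAdj_apply]
  by_cases h : (b : ℕ) = target m d
  · have hd : 0 < (d : ℕ) := Nat.pos_of_mem_divisors d.2
    rw [if_pos h, if_pos h, coeff, ← h, mul_one,
      div_mul_cancel₀ _ (totient_cast_ne_zero (Nat.pos_of_mem_divisors b.2))]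
  · rw [if_neg h, if_neg h, zero_mul, mul_zero]

/-- The additive map `φ_n ↦ φ_{m n}` (Haran 2022, §13: "the 'verschiebung' `F_m^*` is the additive
map given by `F_m^* φ_n = φ_{m·n}`"), truncated to level `N` (zero on `φ_d` when `m d ∤ N`).
[cite: Haran2022, §13] -/
def verschiebung (N m : ℕ) : Matrix N.divisors N.divisors ℚ :=
  Matrix.of fun e d => if (e : ℕ) = m * d then 1 else 0

/-- **Remark (scope).** The verschiebung `φ_n ↦ φ_{mn}` is NOT the adjoint of `F_m` for the
inner product `⟨φ_a, φ_b⟩ = δ_{ab} φ(a)`: already `⟨F_2 φ_1, φ_1⟩ = ⟨φ_1, φ_1⟩ = 1` while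
`⟨φ_1, φ_2⟩ = 0`; at level `N = 2` the matrix identity `F_2ᵀ G = G V_2` fails. (The
`⟨·,·⟩`-adjoint is `frobAdj`, `frob_transpose_mul_gram`.) [cite: Haran2022, §13] -/
theorem frob_transpose_mul_gram_ne_verschiebung :
    (frob 2 2)ᵀ * gram 2 ≠ gram 2 * verschiebung 2 2 := by
  intro h
  have h1 : (1 : ℕ) ∈ (2 : ℕ).divisors := by decide
  have := congr_fun (congr_fun h ⟨1, h1⟩) ⟨1, h1⟩
  rw [gram, Matrix.mul_diagonal, Matrix.diagonal_mul, Matrix.transpose_apply, frob_apply,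
    verschiebung] at this
  norm_num [target, coeff] at this

/-! ### The trace functional `t_m = tr ∘ F_m` and Ramanujan sums -/

open scoped ArithmeticFunction.Moebius in
/-- **`t_m(φ_d) = μ(d/(d,m)) · φ(d)/φ(d/(d,m))`** (Haran 2022, §13: `tr(φ_n) = ∑_{ξ ∈ μ_n^*} ξ = μ(n)`,
`t_m = tr ∘ F_m`, `t_m(φ_n) = tr(F_m φ_n) = ∑_{ξ ∈ μ_n^*} ξ^m = C_n^m` with the Ramanujan sum
`C_n^m = μ(n/(n,m)) · φ(n)/φ(n/(n,m))` — Hölder's evaluation, Hardy–Wright Thm 272): at level `N`,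
pairing the column of `φ_d` in `F_m` with the row vector `(μ(e))_{e ∣ N}` gives exactly the
printed value. [cite: Haran2022, §13] -/
theorem moebius_dotProduct_frob (N m : ℕ) (d : N.divisors) :
    ∑ e : N.divisors, (μ (e : ℕ) : ℚ) * frob N m e d = (μ (target m d) : ℚ) * coeff m d := by
  rw [Finset.sum_eq_single (targetIdx m d)]
  · rw [frob_apply, coe_targetIdx, if_pos rfl]
  · intro e _ he
    rw [frob_apply, if_neg (show ¬ ((e : ℕ) = target m d) from fun h => he (Subtype.ext h)),
      mul_zero]
  · intro h; exact absurd (Finset.mem_univ _) h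

/-! ### The orbit model: `φ_n = [μ_n^*]` and `F_m [ξ] = [ξ^m]` -/

/-- **Why `F_m φ_n` is a multiple of `φ_{n/(m,n)}`.** In Haran's description
`𝒲(Spec ℤ ∪ {η}) = ⊕_{n ≥ 1} ℤ[μ_n^*]` (free on Galois orbits of roots of unity, `φ_n` = the orbit
of primitive `n`-th roots) with `F_m [α] = [α^m]` (§12, `F_n[p] = [p^n]`; §13 first display), the
`m`-th power of a primitive `n`-th root of unity is a primitive `n/(m,n)`-th root of unity — in
any commutative monoid. (The multiplicity `φ(n)/φ(n/(m,n))` of the orbit map is `coeff`; it is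
pinned by the printed trace `t_m(φ_n)`, `moebius_dotProduct_frob`.) [cite: Haran2022, §12–§13] -/
theorem isPrimitiveRoot_pow_target {M : Type*} [CommMonoid M] {ζ : M} {n : ℕ} (hn : 0 < n)
    (h : IsPrimitiveRoot ζ n) (m : ℕ) : IsPrimitiveRoot (ζ ^ m) (target m n) := by
  have hg0 : 0 < Nat.gcd m n := Nat.gcd_pos_of_pos_right m hn
  obtain ⟨m', hm'⟩ := Nat.gcd_dvd_left m n
  have h1 : IsPrimitiveRoot (ζ ^ Nat.gcd m n) (target m n) :=
    h.pow_of_dvd hg0.ne' (Nat.gcd_dvd_right m n)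
  have hcop : Nat.Coprime m' (target m n) := by
    have := Nat.coprime_div_gcd_div_gcd hg0
    rw [Nat.div_eq_of_eq_mul_right hg0 hm'] at this
    exact this
  rw [show ζ ^ m = (ζ ^ Nat.gcd m n) ^ m' by rw [← pow_mul, ← hm']]
  exact h1.pow_of_coprime m' hcop

end HaranWitt

end Literature.NumberTheory.F1Geometry
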